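import Literature.Geometry.Kaehler.AnalyticSetManifoldPiece
import Literature.Geometry.Kaehler.IrreducibleComponentsProofs
import HarnessLib

/-!
# The singular locus and intersections of components have smaller dimension

Consequences of `Literature.Geometry.Kaehler.SCV.exists_isRegPt_nhds_subset_of_subset`
(`AnalyticSetManifoldPiece.lean`: a `p`-dimensional submanifold piece of an analytic set of
dimension `≤ p` carries regular points of the set near which the two coincide):

* `Literature.Geometry.Kaehler.SCV.IsRegPt.exists_subset_isRegPt_of_le` — cutting a submanifold
  piece down: a regular point of codimension `c` of `N` is a regular point of codimension `c' ≥ c`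
  of a smaller set `N' ⊆ N` (intersect with a generic affine subspace through the point);
  hence `Literature.Geometry.Kaehler.SCV.exists_isRegPt_nhds_subset_of_subset_of_le`, the main
  lemma for pieces of dimension `≥ p`.
* `Literature.Geometry.Kaehler.IsAnalyticSet.succ_le_codim_singularLocus` — **`dim sng A < dim A`**
  [Chirka1989, §5.2 Thm. 2]: if every regular point of the analytic set `Z` has codimension
  `≥ c₀`, every regular point of `sng Z` has codimension `≥ c₀ + 1` (on a complex manifold).
* `Literature.Geometry.Kaehler.IsIrreducibleAnalyticSet.subset_of_isRegularPointOfCodim_inter`,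
  `Literature.Geometry.Kaehler.IsIrreducibleAnalyticSet.succ_le_codim_inter` —
  **`dim (A ∩ A') < dim A`** for distinct irreducible analytic sets of the same pure codimension
  [Chirka1989, §5.3 Cor. 1–2]: every regular point of `Z ∩ Z'` has codimension `≥ c₀ + 1`
  (with the uniqueness theorem `IsIrreducibleAnalyticSet.subset_of_isOpen_inter_subset`).

No named facts, no definitions.

## References

* E. M. Chirka, *Complex Analytic Sets*, Kluwer (1989), Ch. 1 §5.2 Thm. 2 (p. 53), §5.3 Cor. 1–2
  (pp. 54–55) [Chirka1989].
-/

open Complex Metric Set Filter Function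
open scoped Topology Manifold

namespace Literature.Geometry.Kaehler

variable {E : Type*} [NormedAddCommGroup E] [NormedSpace ℂ E]

namespace SCV

section Model

variable [FiniteDimensional ℂ E]

/-- Restriction to the first coordinates `ℂⁿ → ℂᵏ`, `k ≤ n`, is onto. [folklore] -/
theorem surjective_comp_castLE {k n : ℕ} (h : k ≤ n) :
    Function.Surjective fun v : Fin n → ℂ => fun i : Fin k => v (Fin.castLE h i) := by
  classical
  intro u
  refine ⟨fun j => if hj : (j : ℕ) < k then u ⟨j, hj⟩ else 0, funext fun i => ?_⟩
  have hi : ((Fin.castLE h i : Fin n) : ℕ) < k := by simp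
  simp only [hi, dif_pos]
  congr 1

/-- **Cutting a submanifold piece down.** If `a ∈ N` is a regular point of codimension `c` of
`N ⊆ E` and `c ≤ c' ≤ dim E`, there is `N' ⊆ N` through `a` of which `a` is a regular point of
codimension `c'`: intersect `N` with the zero set of `c' - c` linear forms which are independent
on the tangent space `ker dg(a)`. [Chirka, *Complex Analytic Sets*, §2.3] [folklore] -/
theorem IsRegPt.exists_subset_isRegPt_of_le {N : Set E} {a : E} {c c' : ℕ} (h : IsRegPt N c a)
    (haN : a ∈ N) (hcc' : c ≤ c') (hc' : c' ≤ Module.finrank ℂ E) :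
    ∃ N' ⊆ N, a ∈ N' ∧ IsRegPt N' c' a := by
  obtain ⟨U, hUo, haU, g, hg, hNU, hsurj⟩ := h
  set n := Module.finrank ℂ E with hn
  -- the tangent space and its dimension
  set Kx : Submodule ℂ E :=
    LinearMap.ker ((fderiv ℂ g a : E →L[ℂ] (Fin c → ℂ)) : E →ₗ[ℂ] (Fin c → ℂ)) with hKx
  have hKdim : Module.finrank ℂ Kx = n - c := by
    have h1 := LinearMap.finrank_range_add_finrank_ker
      ((fderiv ℂ g a : E →L[ℂ] (Fin c → ℂ)) : E →ₗ[ℂ] (Fin c → ℂ))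
    rw [LinearMap.range_eq_top.2 hsurj, finrank_top, Module.finrank_fin_fun, ← hKx] at h1
    omega
  -- `c' - c` linear forms, independent on `Kx`
  have hle : c' - c ≤ n - c := by omega
  set κ : Kx ≃L[ℂ] (Fin (n - c) → ℂ) := ContinuousLinearEquiv.ofFinrankEq (by simp [hKdim])
    with hκ
  set π : (Fin (n - c) → ℂ) →L[ℂ] (Fin (c' - c) → ℂ) :=
    ContinuousLinearMap.pi fun i => ContinuousLinearMap.proj (Fin.castLE hle i) with hπ
  have hπsurj : Function.Surjective π := surjective_comp_castLE hle
  obtain ⟨C, hC⟩ := Kx.exists_isCompl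
  set P : E →L[ℂ] Kx := LinearMap.toContinuousLinearMap (Kx.projectionOnto C hC) with hP
  have hPk : ∀ k : Kx, P k = k := fun k => Submodule.projectionOnto_apply_left hC k
  set lam : E →L[ℂ] (Fin (c' - c) → ℂ) := π.comp ((κ : Kx →L[ℂ] (Fin (n - c) → ℂ)).comp P)
    with hlam
  have hlamk : ∀ k : Kx, lam k = π (κ k) := fun k => by simp [hlam, hPk]
  have hlamsurj : ∀ v, ∃ k : Kx, lam k = v := fun v => by
    obtain ⟨w, hw⟩ := hπsurj v
    refine ⟨κ.symm w, ?_⟩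
    rw [hlamk, ContinuousLinearEquiv.apply_symm_apply, hw]
  -- the combined equations
  set G : E → (Fin c → ℂ) × (Fin (c' - c) → ℂ) := fun x => (g x, lam (x - a)) with hG
  have hGd : DifferentiableOn ℂ G U :=
    hg.prodMk ((lam.differentiable.comp (differentiable_id.sub_const a)).differentiableOn)
  have hGa : HasFDerivAt G ((fderiv ℂ g a).prod lam) a := by
    have h1 : HasFDerivAt g (fderiv ℂ g a) a :=
      (hg.differentiableAt (hUo.mem_nhds haU)).hasFDerivAt
    have h2 : HasFDerivAt (fun x => lam (x - a)) lam a := by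
      have := lam.hasFDerivAt.comp a ((hasFDerivAt_id a).sub_const a)
      rwa [ContinuousLinearMap.comp_id] at this
    exact h1.prodMk h2
  have hGsurj : Function.Surjective ((fderiv ℂ g a).prod lam) := by
    rintro ⟨u, v⟩
    obtain ⟨e₁, he₁⟩ := hsurj u
    obtain ⟨k, hk⟩ := hlamsurj (v - lam e₁)
    refine ⟨e₁ + k, ?_⟩
    have hk0 : fderiv ℂ g a k = 0 := by
      have h : (k : E) ∈ LinearMap.ker ((fderiv ℂ g a : E →L[ℂ] (Fin c → ℂ)) :
          E →ₗ[ℂ] (Fin c → ℂ)) := by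
        rw [← hKx]; exact k.2
      exact LinearMap.mem_ker.1 h
    simp only [ContinuousLinearMap.prod_apply, map_add, he₁, hk0, hk, Prod.mk_add_mk, add_zero,
      add_sub_cancel]
  have hfin : Module.finrank ℂ ((Fin c → ℂ) × (Fin (c' - c) → ℂ)) =
      Module.finrank ℂ (Fin c' → ℂ) := by
    simp only [Module.finrank_prod, Module.finrank_fin_fun]
    omega
  set e : ((Fin c → ℂ) × (Fin (c' - c) → ℂ)) ≃L[ℂ] (Fin c' → ℂ) :=
    ContinuousLinearEquiv.ofFinrankEq hfin with he
  refine ⟨N ∩ {x | lam (x - a) = 0}, inter_subset_left, ⟨haN, by simp⟩, U, hUo, haU, e ∘ G,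
    e.differentiable.comp_differentiableOn hGd, ?_, ?_⟩
  · ext x
    simp only [mem_inter_iff, mem_setOf_eq, mem_preimage, mem_singleton_iff, Function.comp_apply]
    rw [e.injective.eq_iff' (map_zero e)]
    constructor
    · rintro ⟨⟨hxN, hx0⟩, hxU⟩
      have hgx : g x = 0 := (hNU.subset ⟨hxN, hxU⟩).2
      exact ⟨hxU, Prod.ext hgx hx0⟩
    · rintro ⟨hxU, hGx⟩
      have hgx : g x = 0 := congrArg Prod.fst hGx
      exact ⟨⟨(hNU.symm.subset ⟨hxU, hgx⟩).1, congrArg Prod.snd hGx⟩, hxU⟩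
  · have hd : HasFDerivAt (e ∘ G) ((e : _ →L[ℂ] _).comp ((fderiv ℂ g a).prod lam)) a :=
      e.hasFDerivAt.comp a hGa
    rw [hd.fderiv]
    exact e.surjective.comp hGsurj

/-- **Submanifold pieces of dimension `≥ p` carry regular points** (the main lemma of
`AnalyticSetManifoldPiece.lean` for a piece `N ⊆ A` of which `a` is a regular point of any
codimension `c ≤ n - p`): in every neighbourhood of `a` there is `b ∈ N` which is a regular point
of `A` of codimension `n - p`, with an open `O ∋ b` such that `A ∩ O ⊆ N`.
[Chirka, *Complex Analytic Sets*, §3.7 Thm., §5.2 Thm. 2, §5.3 Cor. 1] [folklore] -/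
theorem exists_isRegPt_nhds_subset_of_subset_of_le {A N : Set E} {a : E} {p c : ℕ}
    (hA : Literature.Analysis.Complex.SCV.IsZeroSetAt A a) (haA : a ∈ A)
    (hdim : ∀ᶠ x in 𝓝 a, x ∈ A → ∀ q, IsRegPt A q x → Module.finrank ℂ E ≤ q + p)
    (hNA : N ⊆ A) (haN : a ∈ N) (hN : IsRegPt N c a) (hc : c ≤ Module.finrank ℂ E - p)
    {W : Set E} (hW : W ∈ 𝓝 a) :
    ∃ b ∈ N, b ∈ W ∧ IsRegPt A (Module.finrank ℂ E - p) b ∧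
      ∃ O : Set E, IsOpen O ∧ b ∈ O ∧ A ∩ O ⊆ N := by
  obtain ⟨N', hN'N, haN', hN'⟩ := hN.exists_subset_isRegPt_of_le haN hc (Nat.sub_le _ _)
  obtain ⟨b, hbN', hbW, hb, O, hO, hbO, hAO⟩ :=
    exists_isRegPt_nhds_subset_of_subset hA haA hdim (hN'N.trans hNA) haN' hN' hW
  exact ⟨b, hN'N hbN', hbW, hb, O, hO, hbO, hAO.trans hN'N⟩

end Model

end SCV

/-! ### Transfer to complex manifolds -/

section Manifold

open SCV Literature.Analysis.Complex.SCV

variable {H : Type*} [TopologicalSpace H] {I : ModelWithCorners ℂ E H}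
  {M : Type*} [TopologicalSpace M] [ChartedSpace H M]
  [FiniteDimensional ℂ E] [IsManifold I 1 M] [I.Boundaryless]

omit [FiniteDimensional ℂ E] [I.Boundaryless] in
/-- The dimension bound in a chart: if every regular point of the analytic set `Z` has codimension
`≥ c₀`, then near every point of the chart image `chartImage I y Z` every regular point `e` of it
of codimension `q` satisfies `dim E ≤ q + (dim E - c₀)`. [folklore] -/
theorem eventually_finrank_le_of_le_codim {Z : Set M} {c₀ : ℕ}
    (hc₀ : ∀ z c, z ∈ Z → IsRegularPointOfCodim I Z c z → c₀ ≤ c) (y : M) (e₀ : E) :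
    ∀ᶠ e in 𝓝 e₀, e ∈ chartImage I y Z → ∀ q, IsRegPt (chartImage I y Z) q e →
      Module.finrank ℂ E ≤ q + (Module.finrank ℂ E - c₀) := by
  refine Eventually.of_forall fun e he q hq => ?_
  obtain ⟨het, heZ⟩ := he
  have hzs : (extChartAt I y).symm e ∈ (extChartAt I y).source := (extChartAt I y).map_target het
  have hee : e = extChartAt I y ((extChartAt I y).symm e) := ((extChartAt I y).right_inv het).symm
  rw [hee] at hq
  have := hc₀ _ q heZ (isRegularPointOfCodim_of_isRegPt_chartImage hzs hq)
  omega

/-- **The singular locus has smaller dimension** [Chirka1989, §5.2 Thm. 2: "`dim_z (sng A) <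
dim_z A`"], in codimension form: if every regular point of the analytic subset `Z` of a complex
manifold has codimension `≥ c₀`, then every regular point of `sng Z` has codimension `≥ c₀ + 1`.
Proof: a regular point of `sng Z` of codimension `≤ c₀` would give, in a chart, a submanifold
piece of `sng Z ⊆ Z` of dimension `≥ dim Z`, which carries regular points of `Z`
(`SCV.exists_isRegPt_nhds_subset_of_subset_of_le`) — absurd. [cite: Chirka1989, §5.2 Thm. 2, p. 53] -/
theorem IsAnalyticSet.succ_le_codim_singularLocus {Z : Set M} (hZ : IsAnalyticSet I Z) {c₀ : ℕ}
    (hc₀ : ∀ z c, z ∈ Z → IsRegularPointOfCodim I Z c z → c₀ ≤ c) {y : M} {c : ℕ}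
    (hy : y ∈ singularLocus I Z) (hreg : IsRegularPointOfCodim I (singularLocus I Z) c y) :
    c₀ + 1 ≤ c := by
  by_contra hlt
  have hc : c ≤ c₀ := by omega
  set n := Module.finrank ℂ E with hn
  have hys : y ∈ (extChartAt I y).source := mem_extChartAt_source y
  have hcn : c ≤ n := hreg.le_finrank
  -- in the chart at `y`
  set A : Set E := chartImage I y Z with hA
  set N : Set E := chartImage I y (singularLocus I Z) with hN
  have hAz : IsZeroSetAt A (extChartAt I y y) := (hZ y).isZeroSetAt_chartImage hys
  have haA : extChartAt I y y ∈ A :=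
    ⟨(extChartAt I y).map_source hys, by rw [mem_preimage, (extChartAt I y).left_inv hys]; exact hy.1⟩
  have haN : extChartAt I y y ∈ N :=
    ⟨(extChartAt I y).map_source hys, by rw [mem_preimage, (extChartAt I y).left_inv hys]; exact hy⟩
  have hNA : N ⊆ A := fun e he => ⟨he.1, he.2.1⟩
  have hNreg : IsRegPt N c (extChartAt I y y) := hreg.isRegPt_chartImage hys
  obtain ⟨b, hbN, -, hb, -⟩ := exists_isRegPt_nhds_subset_of_subset_of_le hAz haA
    (eventually_finrank_le_of_le_codim hc₀ y _) hNA haN hNreg (by omega) univ_mem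
  -- `b` corresponds to a point of `sng Z` which is a regular point of `Z`
  obtain ⟨hbt, hbs⟩ := hbN
  have hzs : (extChartAt I y).symm b ∈ (extChartAt I y).source := (extChartAt I y).map_target hbt
  have hbb : b = extChartAt I y ((extChartAt I y).symm b) := ((extChartAt I y).right_inv hbt).symm
  rw [hbb] at hb
  exact hbs.2 ⟨hbs.1, _, isRegularPointOfCodim_of_isRegPt_chartImage hzs hb⟩

/-- **An irreducible component is determined by a top-dimensional piece of an intersection**:
if `Z` is irreducible of pure codimension `c₀`, `Z'` is analytic, and `Z ∩ Z'` has a regular point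
of codimension `≤ c₀`, then `Z ⊆ Z'`: the corresponding submanifold piece of `Z ∩ Z' ⊆ Z` carries,
in a chart, a nonempty relatively open subset of `Z` (`SCV.exists_isRegPt_nhds_subset_of_subset_of_le`),
and the uniqueness theorem for irreducible analytic sets
(`IsIrreducibleAnalyticSet.subset_of_isOpen_inter_subset`) applies.
[cite: Chirka1989, §5.3 Cor. 1, p. 55] -/
theorem IsIrreducibleAnalyticSet.subset_of_isRegularPointOfCodim_inter {Z Z' : Set M}
    (hZ : IsIrreducibleAnalyticSet I Z) (hZ' : IsAnalyticSet I Z') {c₀ : ℕ}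
    (hZc : HasPureCodim I Z c₀) {y : M} {c : ℕ} (hy : y ∈ Z ∩ Z')
    (hreg : IsRegularPointOfCodim I (Z ∩ Z') c y) (hc : c ≤ c₀) : Z ⊆ Z' := by
  set n := Module.finrank ℂ E with hn
  have hys : y ∈ (extChartAt I y).source := mem_extChartAt_source y
  have hcn : c ≤ n := hreg.le_finrank
  have hc₀ : ∀ z c, z ∈ Z → IsRegularPointOfCodim I Z c z → c₀ ≤ c := fun z c hz h =>
    ((hZc.2.2 z ⟨hz, c, h⟩).codim_unique hz h).le
  -- in the chart at `y`
  set A : Set E := chartImage I y Z with hA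
  set N : Set E := chartImage I y (Z ∩ Z') with hN
  have hAz : IsZeroSetAt A (extChartAt I y y) := (hZ.1 y).isZeroSetAt_chartImage hys
  have haA : extChartAt I y y ∈ A :=
    ⟨(extChartAt I y).map_source hys, by rw [mem_preimage, (extChartAt I y).left_inv hys]; exact hy.1⟩
  have haN : extChartAt I y y ∈ N :=
    ⟨(extChartAt I y).map_source hys, by rw [mem_preimage, (extChartAt I y).left_inv hys]; exact hy⟩
  have hNA : N ⊆ A := fun e he => ⟨he.1, he.2.1⟩
  have hNreg : IsRegPt N c (extChartAt I y y) := hreg.isRegPt_chartImage hys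
  obtain ⟨b, hbN, -, -, O, hO, hbO, hAO⟩ := exists_isRegPt_nhds_subset_of_subset_of_le hAz haA
    (eventually_finrank_le_of_le_codim hc₀ y _) hNA haN hNreg (by omega) univ_mem
  -- the relatively open subset `Z ∩ O_M` of `Z` lies in `Z'`
  set OM : Set M := (extChartAt I y).source ∩ extChartAt I y ⁻¹' O with hOM
  have hOMo : IsOpen OM := by
    have h := isOpen_extChartAt_preimage (I := I) y hO
    rwa [← extChartAt_source I] at h
  obtain ⟨hbt, hbZZ'⟩ := hbN
  have hzs : (extChartAt I y).symm b ∈ (extChartAt I y).source := (extChartAt I y).map_target hbt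
  have hne : (Z ∩ OM).Nonempty := by
    refine ⟨(extChartAt I y).symm b, hbZZ'.1, hzs, ?_⟩
    rw [mem_preimage, (extChartAt I y).right_inv hbt]
    exact hbO
  have hsub : Z ∩ OM ⊆ Z' := by
    rintro z ⟨hzZ, hzs', hzO⟩
    have heA : extChartAt I y z ∈ A :=
      ⟨(extChartAt I y).map_source hzs', by
        rw [mem_preimage, (extChartAt I y).left_inv hzs']; exact hzZ⟩
    have heN : extChartAt I y z ∈ N := hAO ⟨heA, hzO⟩
    have := heN.2
    rw [mem_preimage, (extChartAt I y).left_inv hzs'] at this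
    exact this.2
  exact hZ.subset_of_isOpen_inter_subset hZ' hOMo hne hsub

/-- **Distinct irreducible components of the same dimension meet in smaller dimension**
[Chirka1989, §5.3 Cor. 1–2: "`dim A ∩ A' < dim A`"], in codimension form: if `Z ≠ Z'` are
irreducible analytic subsets of a complex manifold, both of pure codimension `c₀`, then every
regular point of `Z ∩ Z'` has codimension `≥ c₀ + 1`. [cite: Chirka1989, §5.3 Cor. 2, p. 55] -/
theorem IsIrreducibleAnalyticSet.succ_le_codim_inter {Z Z' : Set M}
    (hZ : IsIrreducibleAnalyticSet I Z) (hZ' : IsIrreducibleAnalyticSet I Z') {c₀ : ℕ}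
    (hZc : HasPureCodim I Z c₀) (hZ'c : HasPureCodim I Z' c₀) (hne : Z ≠ Z') {y : M} {c : ℕ}
    (hy : y ∈ Z ∩ Z') (hreg : IsRegularPointOfCodim I (Z ∩ Z') c y) : c₀ + 1 ≤ c := by
  by_contra hlt
  have hc : c ≤ c₀ := by omega
  have h₁ : Z ⊆ Z' := hZ.subset_of_isRegularPointOfCodim_inter hZ'.1 hZc hy hreg hc
  have hy' : y ∈ Z' ∩ Z := ⟨hy.2, hy.1⟩
  have hreg' : IsRegularPointOfCodim I (Z' ∩ Z) c y := by rwa [inter_comm]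
  have h₂ : Z' ⊆ Z := hZ'.subset_of_isRegularPointOfCodim_inter hZ.1 hZ'c hy' hreg' hc
  exact hne (h₁.antisymm h₂)

end Manifold

end Literature.Geometry.Kaehler
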